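import Summits.ResolutionOfSingularities.ResolutionOfSingularities.Theorems.FrobeniusClosingSteerAutoPermissibleTwo
import Summits.ResolutionOfSingularities.ResolutionOfSingularities.Theorems.FrobeniusClosingSteerQuadraticStepLemmas
import Summits.ResolutionOfSingularities.ResolutionOfSingularities.Theorems.FrobeniusClosingSteerCore4IsoChartZero
import Summits.ResolutionOfSingularities.ResolutionOfSingularities.Theorems.RuledResiduesRegularModelRuledExceptional
import Literature.AlgebraicGeometry.Resolution.LocalBlowup
import Literature.AlgebraicGeometry.Resolution.QuadraticTransforms
import Literature.AlgebraicGeometry.Resolution.RegularLocalHeights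
import Literature.AlgebraicGeometry.Resolution.RegularLocalRingsQuotient
import Mathlib.Algebra.CharP.Two
import Mathlib.Algebra.CharP.Subring
import Mathlib.Algebra.CharP.Lemmas
import HarnessLib

/-!
# The divisor trigger at `p = 2` — chart lemmas (B1 of res-L0-w41-strat-2's σ-residual HIGH half, part 1/2)

W4.1, crux `Steer` (stmt-ResolutionOfSingularities-16345), σ-line at `p = 2`, regime re-cut §σ2.15/§σ2.16
(res-L0-w41-strat-2, `Sketch-sigma-orders.lean`, `R2TwoSigma-s16-strat2.delta.lean` rev 4 e4924d8597cdaa80;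
res-L0-w41-plan-1 RULING 3 2026-08-27T07:20:27Z: B1 `divisorTrigger_two` → res-D-pv-011 AS res-L0-w41-stub-7).
Theses-free, def-free helper lemmas for one local blowing up `R ⊂ R'` of a regular local subring `R ⊆ K` along its
maximal ideal with respect to a valuation ring `O` (a quadratic transform along `O`), in the chart of an exceptional
parameter `x`:

* `eq_locAtCentre_blowupRing` — `R' = (R[𝔪_R/x])_{𝔪_O ∩ R[𝔪_R/x]}` for EVERY least-value `x ∈ 𝔪_R` (uniqueness of
  the quadratic transform along `O`);
* `isRegularRing_blowupRing_quotient` — `R[𝔪_R/x]/(x)` is a regular ring for `x ∈ 𝔪_R ∖ 𝔪_R²` (the exceptional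
  fibre of the chart is an affine space over `κ(R)`: `RuledResiduesRegularModelRuled.chartQuotient`);
* `isRegularLocalRing_locAtCentre_quotient` — quotient and localisation at the centre commute, so
  `(C)_{𝔪_O ∩ C}/(a)` is regular local when `C/(a)` is a regular ring;
* `isRegularLocalRing_adjoinRoot_bot` — the generic torsor fibre `R_{(0)}[T]/(T^p − f)` is regular when `f = s^p`
  with `s ∉ Frac R` (res-type-082's singularity criterion at the prime `⊥`);
* `eq_bot_of_lt_span_singleton` — a prime strictly below a principal ideal `(x)`, `x ∈ 𝔪`, is `⊥` (Nakayama);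
* `ne_maximalIdeal_of_sigmaTop` — the propositional reading of the skeleton's `IsSigmaTopCentre`: a permissible
  centre forbids the point step.

Part 2/2 (`FrobeniusClosingSteerDivisorTriggerTwo.lean`) assembles B1: the exceptional prime `(x) ⊂ R'` is
σ_top-permissible. No Theses file of W4.1 is imported; nothing here is a route item. OURS (the W4.1 engine),
standard commutative algebra. [cite: Matsumura1987, Thm. 14.2, Thm. 19.4] [cite: NovacoskiSpivakovsky2014, Def. 2.11]
[cite: Cutkosky2014, §2.2]
-/

noncomputable section

-- `Summit.<S>.<S>.…` duplicates the summit name by design (single-problem summit).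
set_option linter.dupNamespace false

open Polynomial IsLocalRing Literature.AlgebraicGeometry.Resolution

namespace Summit.ResolutionOfSingularities.ResolutionOfSingularities.Theorems.SwitchingDichotomy.DivisorTrigger

variable {K : Type} [Field K]

/-! ## §1 The quadratic transform in the chart of ANY least-value element -/

/-- **The local blowing up along `𝔪_R` is the local ring at the centre of the `x`-chart** for every `x ∈ 𝔪_R` of
least value (maximal `O`-valuation): `R' = (R[𝔪_R/x])_{𝔪_O ∩ R[𝔪_R/x]}` (uniqueness of the quadratic transform along
`O`). [cite: NovacoskiSpivakovsky2014, Def. 2.11] [cite: Cutkosky2014, §2.2] -/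
theorem eq_locAtCentre_blowupRing {O : ValuationSubring K} {R R' : Subring K} [IsLocalRing R]
    (hbl : IsLocalBlowupAlong O R (maximalIdeal R) R') {x : K} (hxR : x ∈ R)
    (hxm : (⟨x, hxR⟩ : R) ∈ maximalIdeal R) (hx0 : x ≠ 0)
    (hmax : ∀ y : R, y ∈ maximalIdeal R → O.valuation (y : K) ≤ O.valuation x) :
    R' = locAtCentre (blowupRing R x) O := by
  classical
  have h₁ : IsQuadraticTransformAlong O R R' := ⟨‹_›, hbl⟩
  obtain ⟨hRO, u, u₀, hu, -, -, -, -⟩ := hbl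
  -- the chart datum `insert x u`
  have h₂ : IsQuadraticTransformAlong O R (locAtCentre (blowupRing R x) O) := by
    refine ⟨‹_›, hRO, insert ⟨x, hxR⟩ u, ⟨x, hxR⟩, ?_, Finset.mem_insert_self _ _,
      fun h => hx0 (congrArg Subtype.val h), ?_, ?_⟩
    · rw [Finset.coe_insert, Ideal.span_insert, hu, sup_eq_right]
      exact (Ideal.span_singleton_le_iff_mem _).mpr hxm
    · intro y hy
      rcases Finset.mem_insert.mp hy with rfl | hy
      · exact le_rfl
      · exact hmax y (hu ▸ Ideal.subset_span (Finset.mem_coe.mpr hy))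
    · rw [blowupRing_eq_closure_of_span_eq x (↑(insert (⟨x, hxR⟩ : R) u) : Set R)]
      rw [Finset.coe_insert, Ideal.span_insert, hu, sup_eq_right]
      exact (Ideal.span_singleton_le_iff_mem _).mpr hxm
  exact h₁.unique h₂

/-! ## §2 The exceptional hypersurface of the chart is regular -/

/-- **`R[𝔪_R/x]/(x)` is a regular ring** for a regular local subring `R ⊆ K` and `x ∈ 𝔪_R ∖ 𝔪_R²`: `x` is a member of a
regular system of parameters, and the exceptional fibre of the chart is an affine space over the residue field
(`RuledResiduesRegularModelRuled.chartQuotient`: `R[𝔪/x]/(x) ≅ κ(R)[T_j]`). [cite: Matsumura1987, Thm. 14.2] -/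
theorem isRegularRing_blowupRing_quotient (R : Subring K) [IsRegularLocalRing R] {x : K} (hxR : x ∈ R)
    (hxm : (⟨x, hxR⟩ : R) ∈ maximalIdeal R) (hx2 : (⟨x, hxR⟩ : R) ∉ maximalIdeal R ^ 2) (hx0 : x ≠ 0) :
    IsRegularRing (blowupRing R x ⧸
      Ideal.span {(⟨x, le_blowupRing R x hxR⟩ : blowupRing R x)}) := by
  classical
  set d := (maximalIdeal R).spanFinrank with hd
  -- `d ≠ 0` since `𝔪_R ∋ x ≠ 0`
  have hd0 : d ≠ 0 := by
    intro h0
    have hgen := (IsNoetherian.noetherian (maximalIdeal R)).generators_ncard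
    rw [← hd, h0, Set.ncard_eq_zero (Submodule.FG.finite_generators (IsNoetherian.noetherian _))] at hgen
    have hspan := Submodule.span_generators (maximalIdeal R : Submodule R R)
    rw [hgen, Submodule.span_empty] at hspan
    have hxbot : (⟨x, hxR⟩ : R) ∈ (⊥ : Ideal R) := hspan ▸ hxm
    exact hx0 (congrArg Subtype.val ((Submodule.mem_bot R).mp hxbot))
  obtain ⟨d', hd'⟩ := Nat.exists_eq_succ_of_ne_zero hd0
  obtain ⟨z, hz, hzj⟩ := ChartZero.exists_rsop_apply_eq hd.symm hxm hx2 (⟨0, by omega⟩ : Fin d)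
  have hzi : z ⟨0, by omega⟩ ≠ 0 := by
    rw [hzj]
    exact fun h => hx0 (congrArg Subtype.val h)
  obtain ⟨ψ, hψ, -⟩ := RuledResiduesRegularModelRuled.chartQuotient R hd.symm z hz ⟨0, by omega⟩ hzi
  have e := RingEquiv.ofBijective ψ hψ
  -- transport along `z 0 = x`
  have hco : ((z ⟨0, by omega⟩ : R) : K) = x := by rw [hzj]
  have key : ∀ (y : K) (hy : y ∈ R) (hyx : y = x),
      IsRegularRing (blowupRing R y ⧸ Ideal.span {(⟨y, le_blowupRing R y hy⟩ : blowupRing R y)}) →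
      IsRegularRing (blowupRing R x ⧸ Ideal.span {(⟨x, le_blowupRing R x hxR⟩ : blowupRing R x)}) := by
    intro y hy hyx h
    subst hyx
    exact h
  exact key _ (z ⟨0, by omega⟩).2 hco (IsRegularRing.of_ringEquiv e)

/-- **Quotient and localisation commute**: for a subring `C ⊆ O` and `a ∈ C` in the centre of `O` with `C/(a)` a
regular ring, the local ring `(C)_{𝔪_O ∩ C}/(a)` is a regular local ring — it is the localisation of `C/(a)` at the
image of the centre. [folklore] -/
theorem isRegularLocalRing_locAtCentre_quotient {O : ValuationSubring K} {C : Subring K} (hCO : C ≤ O.toSubring)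
    (a : C) (ha : O.valuation (a : K) < 1)
    [hreg : IsRegularRing (C ⧸ Ideal.span {a})] :
    IsRegularLocalRing (locAtCentre C O ⧸ Ideal.span {algebraMap C (locAtCentre C O) a}) := by
  haveI := isLocalization_locAtCentre hCO
  set Q : Ideal C := subringCentre C O hCO with hQdef
  set T := locAtCentre C O
  set J : Ideal C := Ideal.span {a} with hJ
  have haQ : a ∈ Q := (mem_subringCentre_iff hCO a).mpr ha
  have hJQ : J ≤ Q := (Ideal.span_singleton_le_iff_mem _).mpr haQ
  set Qbar : Ideal (C ⧸ J) := Q.map (Ideal.Quotient.mk J) with hQbar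
  have hcomap : Qbar.comap (Ideal.Quotient.mk J) = Q := by
    rw [hQbar, Ideal.comap_map_of_surjective _ Ideal.Quotient.mk_surjective,
      ← RingHom.ker_eq_comap_bot, Ideal.mk_ker, sup_eq_left]
    exact hJQ
  haveI hQbarp : Qbar.IsPrime :=
    Ideal.map_isPrime_of_surjective Ideal.Quotient.mk_surjective (by rwa [Ideal.mk_ker])
  have hmemQ : ∀ c : C, Ideal.Quotient.mk J c ∈ Qbar ↔ c ∈ Q := fun c => by
    rw [← Ideal.mem_comap, hcomap]
  have hM : Algebra.algebraMapSubmonoid (C ⧸ J) Q.primeCompl = Qbar.primeCompl := by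
    ext b
    constructor
    · rintro ⟨c, hc, rfl⟩
      exact fun h => hc ((hmemQ c).mp h)
    · intro hb
      obtain ⟨c, rfl⟩ := Ideal.Quotient.mk_surjective b
      exact ⟨c, fun h => hb ((hmemQ c).mpr h), rfl⟩
  haveI : IsLocalization.AtPrime (T ⧸ J.map (algebraMap C T)) Qbar := by
    have := (inferInstance : IsLocalization (Algebra.algebraMapSubmonoid (C ⧸ J) Q.primeCompl)
      (T ⧸ J.map (algebraMap C T)))
    rwa [hM] at this
  have e := (IsLocalization.algEquiv Qbar.primeCompl (T ⧸ J.map (algebraMap C T))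
    (Localization.AtPrime Qbar)).toRingEquiv
  haveI hloc : IsRegularLocalRing (Localization.AtPrime Qbar) :=
    IsRegularRing.isRegularLocalRing_localization (R := C ⧸ J) Qbar
  haveI : IsRegularLocalRing (T ⧸ J.map (algebraMap C T)) :=
    IsRegularLocalRing.of_ringEquiv (R := Localization.AtPrime Qbar) e.symm
  have hJt : J.map (algebraMap C T) = Ideal.span {algebraMap C T a} := by
    rw [hJ, Ideal.map_span, Set.image_singleton]
  exact IsRegularLocalRing.of_ringEquiv (Ideal.quotEquivOfEq hJt)

/-! ## §3 The generic torsor fibre: `⊥` is not a singular prime -/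

/-- **If `f` is not a `p`-th power in `Frac R`, the torsor `T^p = f` is regular over the generic point**: for a regular
local subring `R ⊆ K` (`char K = p`), `f = s^p` with `s ∈ K` such that `s·b ∉ R` for all `b ∈ R ∖ 0`, the ring
`R_{(0)}[T]/(T^p − f)` is a regular local ring (the criterion at the prime `⊥`: `f − γ^p ∈ 𝔪_{R_{(0)}}² = 0` would
give `γ = a/b`, `(s b − a)^p = 0`, `s b = a`). [cite: Matsumura1987, Thm. 14.2] -/
theorem isRegularLocalRing_adjoinRoot_bot (p : ℕ) [Fact p.Prime] [CharP K p] (R : Subring K)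
    [IsRegularLocalRing R] (f : R) (s : K) (hf : (f : K) = s ^ p)
    (hirr : ∀ y z : R, (z : K) ≠ 0 → s * z ≠ y) :
    IsRegularLocalRing (AdjoinRoot
      (X ^ p - C (algebraMap R (Localization.AtPrime (⊥ : Ideal R)) f) :
        (Localization.AtPrime (⊥ : Ideal R))[X])) := by
  haveI : IsDomain R := inferInstance
  set L := Localization.AtPrime (⊥ : Ideal R)
  haveI : IsRegularLocalRing L := isRegularLocalRing_localization_atPrime R ⊥
  haveI : CharP L p := AutoPermissible.charP_localization_atPrime (S := R) p ⊥
  by_contra hsing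
  obtain ⟨γ, hγ⟩ := (RadicandSingular.not_isRegularLocalRing_adjoinRoot_atPrime_iff p (⊥ : Ideal R) f).mp hsing
  -- `𝔪_L = 0`, so `f = γ^p` in `L`
  have hmax : maximalIdeal L = ⊥ := by
    rw [← IsLocalization.AtPrime.map_eq_maximalIdeal (⊥ : Ideal R) L, Ideal.map_bot]
  have hγ0 : algebraMap R L f - γ ^ p = 0 := by
    have h := Ideal.pow_le_self (two_ne_zero) hγ
    rwa [hmax, Ideal.mem_bot] at h
  -- write `γ = a / b` and map to `K`
  obtain ⟨⟨a, b⟩, hab⟩ := IsLocalization.mk'_surjective (⊥ : Ideal R).primeCompl γ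
  dsimp only at hab
  subst hab
  have hb0 : ((b : R) : K) ≠ 0 := by
    intro h
    exact b.2 ((Submodule.mem_bot R).mpr (Subtype.ext h))
  have hunit : ∀ y : (⊥ : Ideal R).primeCompl, IsUnit (algebraMap R K y) := by
    intro y
    refine isUnit_iff_ne_zero.mpr fun h => y.2 ((Submodule.mem_bot R).mpr (Subtype.ext ?_))
    simpa using h
  set j : L →+* K := IsLocalization.lift (M := (⊥ : Ideal R).primeCompl) (S := L) hunit with hj
  have hjalg : ∀ r : R, j (algebraMap R L r) = (r : K) := fun r => IsLocalization.lift_eq hunit r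
  have hspec := IsLocalization.mk'_spec L a b
  have hjγ : j (IsLocalization.mk' L a b) * (b : K) = (a : K) := by
    have h := congrArg j hspec
    rw [map_mul, hjalg, hjalg] at h
    exact h
  -- `s^p = (j γ)^p`, hence `s = j γ` (Frobenius is injective on the field `K`)
  have hpow : s ^ p = (j (IsLocalization.mk' L a b)) ^ p := by
    have h := congrArg j (sub_eq_zero.mp hγ0)
    rw [hjalg, map_pow] at h
    rw [← hf, h]
  have hs : s = j (IsLocalization.mk' L a b) := by
    have h0 : (s - j (IsLocalization.mk' L a b)) ^ p = 0 := by
      rw [sub_pow_char (R := K) s (j (IsLocalization.mk' L a b)), hpow, sub_self]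
    exact sub_eq_zero.mp (pow_eq_zero_iff (Fact.out : p.Prime).ne_zero |>.mp h0)
  exact hirr a b hb0 (by rw [hs, hjγ])

/-! ## §4 Primes below a principal prime -/

/-- In a Noetherian local ring, a prime ideal properly contained in a principal ideal `(x)`, `x ∈ 𝔪`, is `⊥`
(`Q = x·Q`, Nakayama). [cite: Matsumura1987, Thm. 14.2] [folklore] -/
theorem eq_bot_of_lt_span_singleton {A : Type*} [CommRing A] [IsLocalRing A] [IsNoetherianRing A] {x : A}
    (hx : x ∈ maximalIdeal A) {Q : Ideal A} [hQ : Q.IsPrime] (hQx : Q ≤ Ideal.span {x})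
    (hne : Q ≠ Ideal.span {x}) : Q = ⊥ := by
  have hxQ : x ∉ Q := fun h => hne (le_antisymm hQx ((Ideal.span_singleton_le_iff_mem _).mpr h))
  refine Submodule.eq_bot_of_le_smul_of_le_jacobson_bot (Ideal.span {x}) Q (IsNoetherian.noetherian Q) ?_ ?_
  · intro q hq
    obtain ⟨c, hc⟩ := Ideal.mem_span_singleton'.mp (hQx hq)
    have hcQ : c ∈ Q := by
      rcases hQ.mem_or_mem (show c * x ∈ Q by rw [hc]; exact hq) with h | h
      · exact h
      · exact absurd h hxQ
    rw [← hc, mul_comm]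
    exact Submodule.smul_mem_smul (Ideal.mem_span_singleton_self x) hcQ
  · exact ((Ideal.span_singleton_le_iff_mem _).mpr hx).trans (maximalIdeal_le_jacobson _)

/-! ## §6 The reading for σ_top: a permissible centre forbids the point step -/

/-- **σ_top does not take the closed point when a permissible centre exists** (pure logic on the body of the
skeleton's `IsSigmaTopCentre R' p f' P'`: `Perm Q` stands for `IsPermissibleCentre R' p f' Q`, whose first clause is
`Q ≠ 𝔪`, and `E` for the point-step multiplicity clause). With `exceptional_isPermissibleCentre` this is strat-2's
`divisorTrigger_two`. OURS. [folklore] -/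
theorem ne_maximalIdeal_of_sigmaTop {A : Type*} [CommRing A] [IsLocalRing A] {Perm : Ideal A → Prop}
    {E : Prop} {P P' : Ideal A} (hP : Perm P) (hPerm : ∀ Q, Perm Q → Q ≠ maximalIdeal A)
    (hσ : Perm P' ∨ (P' = maximalIdeal A ∧ (∀ Q : Ideal A, ¬ Perm Q) ∧ E)) :
    P' ≠ maximalIdeal A := by
  rcases hσ with h | ⟨-, hnone, -⟩
  · exact hPerm P' h
  · exact absurd hP (hnone P)

end Summit.ResolutionOfSingularities.ResolutionOfSingularities.Theorems.SwitchingDichotomy.DivisorTrigger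

end
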